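import Mathlib.RingTheory.Localization.Away.Basic
import Mathlib.RingTheory.Nilpotent.Basic
import Summits.KontsevichZagierPeriods.KontsevichZagierPeriods.Theses.FurushoPentagon

/-!
# Sketch — crux idea `cartier-pullback-nilpotents-are-pi-torsion` for crux ReducedPeriodRing
(item stmt-KontsevichZagierPeriods-3929, route FurushoPentagon).

First checkable statements of the line (elaboration only is required; the three theorems below
are moreover proved):

* `NilpotentsArePiTorsion` — the transfer target C⁺: every square-zero class of the KZ calculus is
  killed by a power of the disc `[π]` (left-nested, exactly the shape of `KZ.PiLocalKernel`).
* `reducedPeriodRing_of_nilpotentsArePiTorsion` — C⁺ ∧ `KZ.PiCancellation` (item 0540 of route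
  AyoubSpecialisation) ⇒ the crux `ReducedPeriodRing`.
* `nilpotentsArePiTorsion_of_transfer` — the abstract CARTIER PULLBACK: any multiplicative additive
  realisation `Θ` of the rules into a commutative ring `B` with a distinguished element `t`
  ("2πi up to a unit") such that (i) `Θ` kills `KZ.relations`, (ii) nilpotents of `B` are
  `t`-power torsion (⇔ `B[1/t]` is reduced — for the cohomological formal period algebra this is
  Nori's torsor theorem + Cartier smoothness, HMS Thm 12.1.3 / Rem 12.2.4), and (iii) the kernel of
  `Θ` is controlled modulo `[π]`-power torsion (`hker`: CubeCompilation + Ayoub 2014 Prop. 11 +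
  the Machin/Weierstrass calibration), forces `NilpotentsArePiTorsion`.
* `tPowerTorsion_of_isReduced_away` — hypothesis (ii) in Mathlib's spelling: if
  `Localization.Away t B` is reduced then every nilpotent of `B` is `t`-power torsion.
-/

namespace Summit.KontsevichZagierPeriods.KontsevichZagierPeriods.Cruxes.ReducedPeriodRing.CartierPullback

open Literature.NumberTheory.Transcendental

/-- C⁺ (transfer target): square-zero classes are `[π]`-power torsion. -/
def NilpotentsArePiTorsion : Prop :=
  ∀ c : KZ.FormalRep, c * c ∈ KZ.relations →
    ∃ N : ℕ, (fun x => KZ.of KZ.piRep * x)^[N] c ∈ KZ.relations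

/-- C⁺ ∧ PiCancellation ⇒ the crux (same induction as the deciding theorem of route
AyoubSpecialisation). -/
theorem reducedPeriodRing_of_nilpotentsArePiTorsion
    (hN : NilpotentsArePiTorsion) (hP : KZ.PiCancellation) :
    Summit.KontsevichZagierPeriods.KontsevichZagierPeriods.Theses.FurushoPentagon.ReducedPeriodRing := by
  intro c hc
  obtain ⟨N, h⟩ := hN c hc
  induction N with
  | zero => simpa using h
  | succ N ih =>
    exact ih (hP _ (by simpa only [Function.iterate_succ_apply'] using h))

/-- The abstract Cartier pullback (all hypotheses unfolded to first order). -/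
theorem nilpotentsArePiTorsion_of_transfer
    (B : Type) [CommRing B] (Θ : KZ.FormalRep →+ B) (t : B)
    (hmul : ∀ a b : KZ.FormalRep, Θ (a * b) = Θ a * Θ b)
    (hrel : ∀ c ∈ KZ.relations, Θ c = 0)
    (hred : ∀ b : B, IsNilpotent b → ∃ N : ℕ, t ^ N * b = 0)
    (hker : ∀ (c : KZ.FormalRep) (N : ℕ), t ^ N * Θ c = 0 →
      ∃ M : ℕ, (fun x => KZ.of KZ.piRep * x)^[M] c ∈ KZ.relations) :
    NilpotentsArePiTorsion := by
  intro c hc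
  have hsq : Θ c ^ 2 = 0 := by
    rw [pow_two, ← hmul]
    exact hrel _ hc
  obtain ⟨N, hN⟩ := hred (Θ c) ⟨2, hsq⟩
  exact hker c N hN

/-- Hypothesis (ii) from Mathlib's `IsReduced (Localization.Away t)`. -/
theorem tPowerTorsion_of_isReduced_away
    (B : Type) [CommRing B] (t : B) [IsReduced (Localization.Away t)]
    (b : B) (hb : IsNilpotent b) : ∃ N : ℕ, t ^ N * b = 0 := by
  have h0 : algebraMap B (Localization.Away t) b = 0 :=
    (hb.map (algebraMap B (Localization.Away t))).eq_zero
  rw [IsLocalization.map_eq_zero_iff (Submonoid.powers t)] at h0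
  obtain ⟨⟨m, ⟨N, rfl⟩⟩, hm⟩ := h0
  exact ⟨N, by simpa using hm⟩

end Summit.KontsevichZagierPeriods.KontsevichZagierPeriods.Cruxes.ReducedPeriodRing.CartierPullback
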